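import Mathlib
import HarnessLib
import Summits.Langlands.Statement
import Summits.Langlands.Langlands.Theses.DepthPrimeSplit
import Summits.Langlands.Langlands.Theses.AuxiliaryLevelSplit
import Summits.Langlands.Langlands.Theses.PrimeSwitchSplit
import Summits.Langlands.Langlands.Theorems.TransientLevelSplitLevelFiniteness
import Summits.Langlands.Langlands.Theorems.IwahoriTransientGalois
import Summits.Langlands.Langlands.Theorems.IwahoriTransientRoots
import Literature.NumberTheory.GaloisRepresentations.ResidualPairIntegrality
import Summits.Langlands.Langlands.Theorems.WeakFernSplitFernSpread

/-!
# FernRankSplit — part 1/2: the SIZE–DEPTH EXCHANGE (decomp-langlands lens-3 gen 30; census twin of node HOME/lens-3/g30/frs/FernRankSplitNode.lean)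

Kernel of the node, split off for the 400-line lint.  Over the g29 currency (`WeakFern`: `IsWeakApproximant`, `IsWeaklyProAutomorphic`,
`IsResiduallyAutomorphic`, from the landed g29 twin `WeakFernSplitFernSpread`):
* §11 vocabulary — C_b `IsBoundedlyWeaklyProAutomorphic` (one finite S and ONE size k serve every radius), wH1 `IsWeaklyResiduallyAutomorphic`,
  C_f `IsFrozenWeaklyProAutomorphic` (one finite family serves every radius);
* §13 the exchange `exchange_explicit` / `exchange`: k cusp forms weakly r-close to ρ off S ⟹ ONE of them strongly s-close for every s ≤ 1 with
  r ≤ s^k (ultrametric product trick on ∏_j (X_{j,v,i} − c_i) reduced against the Frobenius polynomial of ρ); and the three certified dictionary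
  ends in ONE currency: `pro_iff_boundedWeak` (C ⟺ C_b — the route's ONE EQUIV), `residual_iff_weaklyResidual` (H1 ⟺ wH1, Deligne–Serre at
  radius 1), `weakly_iff_frozen` (WA ⟺ C_f), bundled as `ladder_dictionary`.
Part 2/2 (`FernRankSplitFernSpread`) carries the items RANK / EXCH, the splits and the deciding theorems.  0 sorry; axioms propext, Classical.choice, Quot.sound.
-/

set_option linter.dupNamespace false
set_option linter.unusedVariables false

namespace Summit.Langlands.Langlands.Theorems.FernRank

open scoped NumberField Polynomial
open Filter Field IsDedekindDomain
open Literature.NumberTheory.GaloisRepresentations Literature.NumberTheory.Automorphic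
open Summit.Langlands.Langlands.Theorems.TransientLevel Summit.Langlands.Langlands.Theorems.WeakFern
open Summit.Langlands.Langlands.Theses

/-! ## 11. Vocabulary: C_b (bounded-size weak pro-automorphy) -/

section Vocabulary

variable {K : Type} [Field K] [NumberField K] {n : ℕ} {ℓ : ℕ} [Fact ℓ.Prime]

/-- C_b · BOUNDEDLY WEAKLY PRO-AUTOMORPHIC: ONE finite `S` and ONE size `k` such that for every radius `r > 0` some cuspidal family
of EXACTLY `k` members (repetitions allowed) weakly `r`-approximates `ρ` off `S` — `ρ` lies on a branch of the fern of 𝒪-RANK `≤ k`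
(the Hecke algebras `𝕋(π_1 ⊕ … ⊕ π_k)` through which `ρ mod {|·| < r}` factors have bounded rank). -/
def IsBoundedlyWeaklyProAutomorphic (hcpt : isCompact_glFiniteIntegralLevel n K) (ι : PadicAlgCl ℓ ≃+* ℂ)
    (ρ : FramedGaloisRep K (PadicAlgCl ℓ) n) : Prop :=
  ∃ S : Set (HeightOneSpectrum (𝓞 K)), S.Finite ∧ ∃ k : ℕ, ∀ r : NNReal, 0 < r →
    ∃ (π : Fin k → CuspidalAutomorphicRepData n K hcpt) (α : Fin k → HeightOneSpectrum (𝓞 K) → Multiset ℂ),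
      IsWeakApproximant hcpt ι ρ S r k π α

/-- wH1 · WEAKLY RESIDUALLY AUTOMORPHIC: `ρ mod 𝔪` (radius 1) is an `𝒪/𝔪`-point of the Hecke algebra of SOME finite cuspidal family off some
finite `S` (a maximal ideal of `𝕋(π_1 ⊕ … ⊕ π_k)`), no member being asked to be congruent to `ρ`. -/
def IsWeaklyResiduallyAutomorphic (hcpt : isCompact_glFiniteIntegralLevel n K) (ι : PadicAlgCl ℓ ≃+* ℂ)
    (ρ : FramedGaloisRep K (PadicAlgCl ℓ) n) : Prop :=
  ∃ S : Set (HeightOneSpectrum (𝓞 K)), S.Finite ∧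
    ∃ (k : ℕ) (π : Fin k → CuspidalAutomorphicRepData n K hcpt) (α : Fin k → HeightOneSpectrum (𝓞 K) → Multiset ℂ),
      IsWeakApproximant hcpt ι ρ S 1 k π α

/-- C_f · FROZEN WEAKLY PRO-AUTOMORPHIC: ONE finite `S` and ONE finite cuspidal family weakly approximate `ρ` off `S` to EVERY depth —
every `𝒪`-relation of the family holds EXACTLY at `ρ` (`ρ` is an `𝒪`-point of ONE Hecke algebra `𝕋(π_1 ⊕ … ⊕ π_k)` of finite rank). -/
def IsFrozenWeaklyProAutomorphic (hcpt : isCompact_glFiniteIntegralLevel n K) (ι : PadicAlgCl ℓ ≃+* ℂ)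
    (ρ : FramedGaloisRep K (PadicAlgCl ℓ) n) : Prop :=
  ∃ S : Set (HeightOneSpectrum (𝓞 K)), S.Finite ∧
    ∃ (k : ℕ) (π : Fin k → CuspidalAutomorphicRepData n K hcpt) (α : Fin k → HeightOneSpectrum (𝓞 K) → Multiset ℂ),
      ∀ r : NNReal, 0 < r → IsWeakApproximant hcpt ι ρ S r k π α

end Vocabulary

/-! ## 13. Kernel: the SIZE–DEPTH EXCHANGE (weak `r`-approximation by `k` members ⟹ strong `r^{1/k}`-approximation by ONE member) -/

section Exchange

variable {K : Type} [Field K] [NumberField K] {n : ℕ} {ℓ : ℕ} [Fact ℓ.Prime]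
  {hcpt : isCompact_glFiniteIntegralLevel n K} {ι : PadicAlgCl ℓ ≃+* ℂ} {ρ : FramedGaloisRep K (PadicAlgCl ℓ) n}

/-- radius monotonicity of `CloseAt`. -/
theorem closeAt_mono {π : CuspidalAutomorphicRepData n K hcpt} {v : HeightOneSpectrum (𝓞 K)} {s r : NNReal}
    (h : CloseAt ι π ρ s v) (hsr : s ≤ r) : CloseAt ι π ρ r v := by
  obtain ⟨α, hα, hc⟩ := h
  exact ⟨α, hα, fun 𝔓 h𝔓 σ hσ i => (hc 𝔓 h𝔓 σ hσ i).trans_le hsr⟩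

/-- every finite place of a number field carries an arithmetic Frobenius at some prime above it (tree: `primesAbove_nonempty`,
`exists_isArithFrobAt_of_mem_primesAbove_holds`). -/
theorem exists_frob (v : HeightOneSpectrum (𝓞 K)) :
    ∃ g : absoluteGaloisGroup K, ∃ 𝔓 ∈ v.primesAbove, IsArithFrobAt (𝓞 K) g 𝔓 := by
  obtain ⟨𝔓, h𝔓⟩ := v.primesAbove_nonempty
  obtain ⟨g, hg⟩ := HeightOneSpectrum.exists_isArithFrobAt_of_mem_primesAbove_holds h𝔓
  exact ⟨g, 𝔓, h𝔓, hg⟩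

/-- **THE SIZE–DEPTH EXCHANGE.**  If a `k`-member cuspidal family weakly `r`-approximates `ρ` off `S`, `ρ` is unramified off `S`, and
`r ≤ s ^ k` with `s ≤ 1`, then ONE member is strongly `s`-close to `ρ` at every `v ∉ S`.
Proof: otherwise member `j` has a bad datum (place `v_j ∉ S`, Frobenius `σ_j`, index `i_j`) with `|c_{i_j}(ρ(σ_j)) − c_{i_j}(π_j, v_j)| ≥ s`;
the `𝒪`-relation `P = ∏_j (b_j T_{v_j,i_j} − b_j a_j)` (`a_j` the Satake coefficient, `b_j = 1` if `|a_j| ≤ 1`, `b_j = a_j⁻¹` otherwise) is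
satisfied by EVERY member (its own factor vanishes), so `|P(c(ρ))| < r` by weak approximation; but `|P(c(ρ))| = ∏_j |b_j| |c_j − a_j| ≥ s ^ k`
(Frobenius polynomials are integral and independent of the Frobenius at unramified places: tree `valuation_coeff_charpoly_le_one`,
`FramedGaloisRep.IsUnramifiedAt.hasFrobCharpolyAt_charpoly`). -/
theorem exchange_explicit {S : Set (HeightOneSpectrum (𝓞 K))} {r : NNReal} {k : ℕ} {π : Fin k → CuspidalAutomorphicRepData n K hcpt}
    {α : Fin k → HeightOneSpectrum (𝓞 K) → Multiset ℂ} (hw : IsWeakApproximant hcpt ι ρ S r k π α)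
    (hur : ∀ v : HeightOneSpectrum (𝓞 K), v ∉ S → ρ.IsUnramifiedAt v) {s : NNReal} (hs1 : s ≤ 1) (hrs : r ≤ s ^ k) :
    ∃ j : Fin k, ∀ v : HeightOneSpectrum (𝓞 K), v ∉ S → ∀ 𝔓 ∈ v.primesAbove, ∀ σ : absoluteGaloisGroup K, IsArithFrobAt (𝓞 K) σ 𝔓 →
      ∀ i : ℕ, Valued.v ((FramedRep.charpoly ρ σ - arithFrobPolyOfSatake ι v.residueCard 1 (α j v)).coeff i) < s := by
  classical
  by_contra H
  push Not at H
  -- a bad (place, prime, Frobenius, index) for every member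
  choose v hvS 𝔓 h𝔓 σ hσ i hi using H
  -- a uniform choice of Frobenii (at every place)
  choose Φ 𝔔 h𝔔 hΦ using fun w : HeightOneSpectrum (𝓞 K) => exists_frob (K := K) w
  -- at the bad places the chosen Frobenius has the same characteristic polynomial as the bad Frobenius (ρ unramified off S)
  have hceq : ∀ j, FramedRep.charpoly ρ (Φ (v j)) = FramedRep.charpoly ρ (σ j) := fun j =>
    (FramedGaloisRep.IsUnramifiedAt.hasFrobCharpolyAt_charpoly (hur _ (hvS j)) (h𝔓 j) (hσ j)) (𝔔 (v j)) (h𝔔 (v j)) (Φ (v j)) (hΦ (v j))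
  -- the variable, the Satake coefficient `a j` and the Galois coefficient `c j` of member `j` at its bad datum
  let X : Fin k → {w : HeightOneSpectrum (𝓞 K) // w ∉ S} × ℕ := fun j => (⟨v j, hvS j⟩, i j)
  let a : Fin k → PadicAlgCl ℓ := fun j => (arithFrobPolyOfSatake ι (v j).residueCard 1 (α j (v j))).coeff (i j)
  let c : Fin k → PadicAlgCl ℓ := fun j => (FramedRep.charpoly ρ (σ j)).coeff (i j)
  have hc1 : ∀ j, Valued.v (c j) ≤ 1 := fun j => valuation_coeff_charpoly_le_one ρ _ _
  have hca : ∀ j, s ≤ Valued.v (c j - a j) := fun j => by simpa only [Polynomial.coeff_sub] using hi j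
  -- the scaling `b j ∈ 𝒪` with `b j * a j ∈ 𝒪` and `|b j (c j − a j)| ≥ s`
  have hb : ∀ j, ∃ b : PadicAlgCl ℓ, Valued.v b ≤ 1 ∧ Valued.v (b * a j) ≤ 1 ∧ s ≤ Valued.v (b * (c j - a j)) := by
    intro j
    by_cases ha : Valued.v (a j) ≤ 1
    · exact ⟨1, by simp, by simpa using ha, by simpa using hca j⟩
    · push Not at ha
      have ha0 : a j ≠ 0 := fun h => by simp [h] at ha
      have hva0 : Valued.v (a j) ≠ 0 := (Valuation.ne_zero_iff _).mpr ha0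
      refine ⟨(a j)⁻¹, ?_, ?_, ?_⟩
      · rw [map_inv₀]; exact inv_le_one_of_one_le₀ ha.le
      · rw [inv_mul_cancel₀ ha0, map_one]
      · have hlt : Valued.v (c j) < Valued.v (a j) := (hc1 j).trans_lt ha
        rw [map_mul, map_inv₀, Valuation.map_sub_swap, Valuation.map_sub_eq_of_lt_left _ hlt, inv_mul_cancel₀ hva0]
        exact hs1
  choose b hb1 hba hbs using hb
  -- the killing factors `Q j = (b j) T_{X j} − (b j a j) ∈ 𝒪[T]` and their product
  let B : Fin k → intRing ℓ := fun j => ⟨b j, (Valuation.mem_valuationSubring_iff _ _).mpr (hb1 j)⟩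
  let D : Fin k → intRing ℓ := fun j => ⟨b j * a j, (Valuation.mem_valuationSubring_iff _ _).mpr (hba j)⟩
  let Q : Fin k → MvPolynomial ({w : HeightOneSpectrum (𝓞 K) // w ∉ S} × ℕ) (intRing ℓ) := fun j =>
    MvPolynomial.C (B j) * MvPolynomial.X (X j) - MvPolynomial.C (D j)
  -- member j' kills its own factor, hence the product
  have hPmem : ∀ j' : Fin k, MvPolynomial.eval₂ (intRing ℓ).subtype
      (fun x : {w : HeightOneSpectrum (𝓞 K) // w ∉ S} × ℕ => (arithFrobPolyOfSatake ι x.1.1.residueCard 1 (α j' x.1.1)).coeff x.2)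
        (∏ j, Q j) = 0 := by
    intro j'
    rw [← MvPolynomial.coe_eval₂Hom, map_prod]
    refine Finset.prod_eq_zero (Finset.mem_univ j') ?_
    simp only [Q, map_sub, map_mul, MvPolynomial.eval₂Hom_C, MvPolynomial.eval₂Hom_X']
    exact sub_self (b j' * a j')
  -- the weak relation at ρ (the uniform Frobenius choice is admissible off S)
  have hweak := hw.2 Φ (fun w _ => ⟨𝔔 w, h𝔔 w, hΦ w⟩) (∏ j, Q j) hPmem
  -- evaluate the product at ρ
  have hev : MvPolynomial.eval₂ (intRing ℓ).subtype
      (fun x : {w : HeightOneSpectrum (𝓞 K) // w ∉ S} × ℕ => (FramedRep.charpoly ρ (Φ x.1.1)).coeff x.2) (∏ j, Q j) =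
        ∏ j, b j * (c j - a j) := by
    rw [← MvPolynomial.coe_eval₂Hom, map_prod]
    refine Finset.prod_congr rfl fun j _ => ?_
    simp only [Q, map_sub, map_mul, MvPolynomial.eval₂Hom_C, MvPolynomial.eval₂Hom_X']
    show b j * (FramedRep.charpoly ρ (Φ (v j))).coeff (i j) - b j * a j = b j * (c j - a j)
    rw [hceq j, mul_sub]
  rw [hev, map_prod] at hweak
  -- every factor has valuation ≥ s: the product has valuation ≥ s ^ k ≥ r, contradiction
  have hge : s ^ k ≤ ∏ j, Valued.v (b j * (c j - a j)) :=
    calc s ^ k = ∏ _j : Fin k, s := by simp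
      _ ≤ ∏ j, Valued.v (b j * (c j - a j)) := Finset.prod_le_prod (fun _ _ => zero_le) fun j _ => hbs j
  exact absurd (hrs.trans hge) (not_le.mpr hweak)

/-- THE EXCHANGE, `CloseAt` form: ONE member is strongly `s`-close to `ρ` at every `v ∉ S` (with the family's own Satake parameters). -/
theorem exchange {S : Set (HeightOneSpectrum (𝓞 K))} {r : NNReal} {k : ℕ} {π : Fin k → CuspidalAutomorphicRepData n K hcpt}
    {α : Fin k → HeightOneSpectrum (𝓞 K) → Multiset ℂ} (hw : IsWeakApproximant hcpt ι ρ S r k π α)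
    (hur : ∀ v : HeightOneSpectrum (𝓞 K), v ∉ S → ρ.IsUnramifiedAt v) {s : NNReal} (hs1 : s ≤ 1) (hrs : r ≤ s ^ k) :
    ∃ j : Fin k, ∀ v : HeightOneSpectrum (𝓞 K), v ∉ S → CloseAt ι (π j) ρ s v := by
  obtain ⟨j, hj⟩ := exchange_explicit hw hur hs1 hrs
  exact ⟨j, fun v hv => ⟨α j v, (hw.1 j).2 v hv, hj v hv⟩⟩

/-- `S`-monotonicity of weak approximants: enlarging the excluded set only removes variables (relations over fewer variables are
relations over more variables, `MvPolynomial.rename`; a Frobenius choice off `S'` extends to one off `S`). -/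
theorem weakApproximant_mono {S S' : Set (HeightOneSpectrum (𝓞 K))} {r : NNReal} {k : ℕ}
    {π : Fin k → CuspidalAutomorphicRepData n K hcpt} {α : Fin k → HeightOneSpectrum (𝓞 K) → Multiset ℂ}
    (hw : IsWeakApproximant hcpt ι ρ S r k π α) (hSS' : S ⊆ S') : IsWeakApproximant hcpt ι ρ S' r k π α := by
  classical
  refine ⟨fun j => ⟨(hw.1 j).1, fun v hv => (hw.1 j).2 v fun h => hv (hSS' h)⟩, fun Φ' hΦ' P' hP' => ?_⟩
  choose Ψ 𝔔 h𝔔 hΨ using fun w : HeightOneSpectrum (𝓞 K) => exists_frob (K := K) w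
  let Φ : HeightOneSpectrum (𝓞 K) → absoluteGaloisGroup K := fun w => if w ∈ S' then Ψ w else Φ' w
  have hΦ : ∀ w : HeightOneSpectrum (𝓞 K), w ∉ S → ∃ 𝔓 ∈ w.primesAbove, IsArithFrobAt (𝓞 K) (Φ w) 𝔓 := by
    intro w _
    by_cases hw' : w ∈ S'
    · exact ⟨𝔔 w, h𝔔 w, by simp only [Φ, if_pos hw']; exact hΨ w⟩
    · obtain ⟨𝔓, h𝔓, h⟩ := hΦ' w hw'
      exact ⟨𝔓, h𝔓, by simp only [Φ, if_neg hw']; exact h⟩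
  let ψ : {w : HeightOneSpectrum (𝓞 K) // w ∉ S'} × ℕ → {w : HeightOneSpectrum (𝓞 K) // w ∉ S} × ℕ :=
    fun x => (⟨x.1.1, fun h => x.1.2 (hSS' h)⟩, x.2)
  have key := hw.2 Φ hΦ (MvPolynomial.rename ψ P') fun j => by rw [MvPolynomial.eval₂_rename]; exact hP' j
  rw [MvPolynomial.eval₂_rename] at key
  have e : ((fun x : {w : HeightOneSpectrum (𝓞 K) // w ∉ S} × ℕ => (FramedRep.charpoly ρ (Φ x.1.1)).coeff x.2) ∘ ψ) =
      fun x : {w : HeightOneSpectrum (𝓞 K) // w ∉ S'} × ℕ => (FramedRep.charpoly ρ (Φ' x.1.1)).coeff x.2 := by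
    funext x
    simp only [Function.comp_apply, ψ, Φ, if_neg x.1.2]
  rw [e] at key
  exact key

/-- ONE `min r 1`-close cuspidal `π` off `S` is a one-member weak `r`-approximant off `S` (the g29 dictionary lemma, sized). -/
theorem weakApproximant_one {S : Set (HeightOneSpectrum (𝓞 K))} {r : NNReal} (hr : 0 < r) {π : CuspidalAutomorphicRepData n K hcpt}
    (hπ : π.1.IsLAlgebraic) (hclose : ∀ v : HeightOneSpectrum (𝓞 K), v ∉ S → CloseAt ι π ρ (min r 1) v) :
    ∃ α : HeightOneSpectrum (𝓞 K) → Multiset ℂ, IsWeakApproximant hcpt ι ρ S r 1 (fun _ => π) (fun _ => α) := by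
  classical
  have hr1 : 0 < min r 1 := lt_min hr one_pos
  let α : HeightOneSpectrum (𝓞 K) → Multiset ℂ := fun v => if hv : v ∉ S then Classical.choose (hclose v hv) else 0
  have hα : ∀ v (hv : v ∉ S), π.1.HasSatakeParamAt v (α v) ∧ ∀ 𝔓 ∈ v.primesAbove, ∀ σ : absoluteGaloisGroup K, IsArithFrobAt (𝓞 K) σ 𝔓 →
      ∀ i : ℕ, Valued.v ((FramedRep.charpoly ρ σ - arithFrobPolyOfSatake ι v.residueCard 1 (α v)).coeff i) < min r 1 := fun v hv => by
    simp only [α, dif_pos hv]; exact Classical.choose_spec (hclose v hv)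
  refine ⟨α, fun _ => ⟨hπ, fun v hv => (hα v hv).1⟩, fun Φ hΦ P hP => ?_⟩
  have hx : ∀ s : {v : HeightOneSpectrum (𝓞 K) // v ∉ S} × ℕ, Valued.v ((FramedRep.charpoly ρ (Φ s.1.1)).coeff s.2) ≤ 1 :=
    fun s => valuation_coeff_charpoly_le_one ρ _ _
  have hxy : ∀ s : {v : HeightOneSpectrum (𝓞 K) // v ∉ S} × ℕ,
      Valued.v ((FramedRep.charpoly ρ (Φ s.1.1)).coeff s.2 - (arithFrobPolyOfSatake ι s.1.1.residueCard 1 (α s.1.1)).coeff s.2) < min r 1 := fun s => by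
    obtain ⟨𝔓, h𝔓, hfrob⟩ := hΦ s.1.1 s.1.2
    simpa only [Polynomial.coeff_sub] using (hα s.1.1 s.1.2).2 𝔓 h𝔓 (Φ s.1.1) hfrob s.2
  have hy : ∀ s : {v : HeightOneSpectrum (𝓞 K) // v ∉ S} × ℕ, Valued.v ((arithFrobPolyOfSatake ι s.1.1.residueCard 1 (α s.1.1)).coeff s.2) ≤ 1 := fun s => by
    simpa only [sub_sub_cancel] using (Valuation.map_sub Valued.v _ _).trans (max_le (hx s) ((hxy s).le.trans (min_le_right _ _)))
  have key := valuation_eval₂_sub_lt P hx hy hr1 hxy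
  rw [hP 0, sub_zero] at key
  exact key.trans_le (min_le_left _ _)

/-- C ⟹ C_b with size ONE. -/
theorem boundedWeak_of_pro (h : IsProAutomorphic hcpt ι ρ) : IsBoundedlyWeaklyProAutomorphic hcpt ι ρ := by
  obtain ⟨S, hS, h⟩ := h
  refine ⟨S, hS, 1, fun r hr => ?_⟩
  obtain ⟨π, hπ, hclose⟩ := h (min r 1) (lt_min hr one_pos)
  obtain ⟨α, hw⟩ := weakApproximant_one hr hπ hclose
  exact ⟨fun _ => π, fun _ => α, hw⟩

/-- C_b ⟹ C for an a.e.-unramified `ρ` (THE EXCHANGE at work: weak `min(r,1)^k`-approximation by `k` members off `S ∪ Ram(ρ)` gives ONE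
`min(r,1)`-close member). -/
theorem pro_of_boundedWeak (hur : ∀ᶠ v : HeightOneSpectrum (𝓞 K) in cofinite, ρ.IsUnramifiedAt v)
    (h : IsBoundedlyWeaklyProAutomorphic hcpt ι ρ) : IsProAutomorphic hcpt ι ρ := by
  obtain ⟨S, hS, k, h⟩ := h
  let S' : Set (HeightOneSpectrum (𝓞 K)) := S ∪ {v | ¬ ρ.IsUnramifiedAt v}
  have hS' : S'.Finite := hS.union (Filter.eventually_cofinite.mp hur)
  have hur' : ∀ v : HeightOneSpectrum (𝓞 K), v ∉ S' → ρ.IsUnramifiedAt v := fun v hv => by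
    by_contra h'
    exact hv (Or.inr h')
  refine ⟨S', hS', fun r hr => ?_⟩
  have hs : 0 < min r 1 := lt_min hr one_pos
  obtain ⟨π, α, hw⟩ := h ((min r 1) ^ k) (pow_pos hs k)
  obtain ⟨j, hj⟩ := exchange (weakApproximant_mono hw Set.subset_union_left) hur' (min_le_right r 1) le_rfl
  exact ⟨π j, (hw.1 j).1, fun v hv => closeAt_mono (hj v hv) (min_le_left r 1)⟩

/-- **THE ONE CERTIFIED TRANSLATION (lens-3's single EQUIV, modulo nothing but a.e.-unramifiedness, which the frame supplies):**
bounded-level pro-automorphy (C: ONE genuine cuspidal eigenform per radius) ⟺ bounded-SIZE weak pro-automorphy (C_b: ONE Hecke algebra of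
bounded rank per radius). -/
theorem pro_iff_boundedWeak (hur : ∀ᶠ v : HeightOneSpectrum (𝓞 K) in cofinite, ρ.IsUnramifiedAt v) :
    IsProAutomorphic hcpt ι ρ ↔ IsBoundedlyWeaklyProAutomorphic hcpt ι ρ :=
  ⟨boundedWeak_of_pro, pro_of_boundedWeak hur⟩

/-- THE RESIDUAL END OF THE SAME DICTIONARY (Deligne–Serre direction, radius 1): `ρ̄` is a point of the Hecke algebra of SOME finite cuspidal
family ⟺ `ρ̄ ≡` ONE cuspidal eigenform a.e. — maximal ideals of `𝕋(π_1 ⊕ … ⊕ π_k)` are residual eigensystems of MEMBERS (the exchange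
at `r = s = 1`). -/
theorem residual_iff_weaklyResidual (hur : ∀ᶠ v : HeightOneSpectrum (𝓞 K) in cofinite, ρ.IsUnramifiedAt v) :
    IsResiduallyAutomorphic hcpt ι ρ ↔ IsWeaklyResiduallyAutomorphic hcpt ι ρ := by
  constructor
  · rintro ⟨π, hπ, hae⟩
    refine ⟨{v | ¬ CloseAt ι π ρ 1 v}, Filter.eventually_cofinite.mp hae, 1, fun _ => π, ?_⟩
    have hclose : ∀ v : HeightOneSpectrum (𝓞 K), v ∉ {v | ¬ CloseAt ι π ρ 1 v} → CloseAt ι π ρ (min 1 1) v := fun v hv => by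
      rw [min_self]; by_contra h; exact hv h
    obtain ⟨α, hw⟩ := weakApproximant_one one_pos hπ hclose
    exact ⟨fun _ => α, hw⟩
  · rintro ⟨S, hS, k, π, α, hw⟩
    let S' : Set (HeightOneSpectrum (𝓞 K)) := S ∪ {v | ¬ ρ.IsUnramifiedAt v}
    have hS' : S'.Finite := hS.union (Filter.eventually_cofinite.mp hur)
    have hur' : ∀ v : HeightOneSpectrum (𝓞 K), v ∉ S' → ρ.IsUnramifiedAt v := fun v hv => by
      by_contra h'
      exact hv (Or.inr h')
    obtain ⟨j, hj⟩ := exchange (weakApproximant_mono hw Set.subset_union_left) hur' le_rfl (one_pow k).symm.le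
    exact ⟨π j, (hw.1 j).1, Filter.eventually_cofinite.mpr (hS'.subset fun v hv => by by_contra h; exact hv (hj v h))⟩

/-- an EXACTLY compatible cuspidal `π` off `S` is a one-member weak approximant off `S` at EVERY radius with ONE Satake datum
(the Galois and Satake points COINCIDE, so every relation of `π` holds exactly at `ρ`). -/
theorem weakApproximant_of_compatible {S : Set (HeightOneSpectrum (𝓞 K))} {π : CuspidalAutomorphicRepData n K hcpt}
    (hπ : π.1.IsLAlgebraic) (hc : ∀ v : HeightOneSpectrum (𝓞 K), v ∉ S → SatakeFrobCompatibleAt ι π.1 ρ v) :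
    ∃ α : HeightOneSpectrum (𝓞 K) → Multiset ℂ, ∀ r : NNReal, 0 < r → IsWeakApproximant hcpt ι ρ S r 1 (fun _ => π) (fun _ => α) := by
  classical
  let α : HeightOneSpectrum (𝓞 K) → Multiset ℂ := fun v => if hv : v ∉ S then Classical.choose (hc v hv) else 0
  have hα : ∀ v (hv : v ∉ S), π.1.HasSatakeParamAt v (α v) ∧ ρ.IsUnramifiedAt v ∧
      ρ.HasFrobCharpolyAt v (arithFrobPolyOfSatake ι v.residueCard 1 (α v)) := fun v hv => by
    simp only [α, dif_pos hv]; exact Classical.choose_spec (hc v hv)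
  refine ⟨α, fun r hr => ⟨fun _ => ⟨hπ, fun v hv => (hα v hv).1⟩, fun Φ hΦ P hP => ?_⟩⟩
  have e : (fun x : {v : HeightOneSpectrum (𝓞 K) // v ∉ S} × ℕ => (FramedRep.charpoly ρ (Φ x.1.1)).coeff x.2) =
      fun x : {v : HeightOneSpectrum (𝓞 K) // v ∉ S} × ℕ => (arithFrobPolyOfSatake ι x.1.1.residueCard 1 (α x.1.1)).coeff x.2 := by
    funext x
    obtain ⟨𝔓, h𝔓, hfrob⟩ := hΦ x.1.1 x.1.2
    rw [(hα x.1.1 x.1.2).2.2 𝔓 h𝔓 (Φ x.1.1) hfrob]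
  rw [e, hP 0, map_zero]
  exact hr

/-- weak automorphy ⟹ C_f (the one compatible `π`, frozen). -/
theorem frozen_of_weakly (h : IsWeaklyAutomorphic hcpt ι ρ) : IsFrozenWeaklyProAutomorphic hcpt ι ρ := by
  obtain ⟨π, hπ, hcof⟩ := h
  obtain ⟨α, hw⟩ := weakApproximant_of_compatible (ι := ι) (ρ := ρ) (S := {v | ¬ SatakeFrobCompatibleAt ι π.1 ρ v}) hπ
    (fun v hv => by by_contra h; exact hv h)
  exact ⟨_, Filter.eventually_cofinite.mp hcof, 1, fun _ => π, fun _ => α, hw⟩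

/-- C_f ⟹ weak automorphy for an a.e.-unramified `ρ` (THE EXCHANGE at every radius `2^{-m}` + pigeonhole over the finite family + exactness:
a coefficient of valuation `< 2^{-m}` for every `m` vanishes). -/
theorem weakly_of_frozen (hur : ∀ᶠ v : HeightOneSpectrum (𝓞 K) in cofinite, ρ.IsUnramifiedAt v)
    (h : IsFrozenWeaklyProAutomorphic hcpt ι ρ) : IsWeaklyAutomorphic hcpt ι ρ := by
  classical
  obtain ⟨S, hS, k, π, α, hw⟩ := h
  let S' : Set (HeightOneSpectrum (𝓞 K)) := S ∪ {v | ¬ ρ.IsUnramifiedAt v}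
  have hS' : S'.Finite := hS.union (Filter.eventually_cofinite.mp hur)
  have hur' : ∀ v : HeightOneSpectrum (𝓞 K), v ∉ S' → ρ.IsUnramifiedAt v := fun v hv => by
    by_contra h'
    exact hv (Or.inr h')
  -- the radii t ^ m, t = 1/2
  let t : NNReal := 2⁻¹
  have ht0 : 0 < t := by positivity
  have ht1 : t ≤ 1 := by rw [inv_le_one₀ (by positivity)]; norm_num
  have htlt : t < 1 := by rw [inv_lt_one₀ (by positivity)]; norm_num
  have hstep : ∀ m : ℕ, ∃ j : Fin k, ∀ v : HeightOneSpectrum (𝓞 K), v ∉ S' → ∀ 𝔓 ∈ v.primesAbove, ∀ σ : absoluteGaloisGroup K,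
      IsArithFrobAt (𝓞 K) σ 𝔓 → ∀ i : ℕ, Valued.v ((FramedRep.charpoly ρ σ - arithFrobPolyOfSatake ι v.residueCard 1 (α j v)).coeff i) < t ^ m :=
    fun m => exchange_explicit (weakApproximant_mono (hw ((t ^ m) ^ k) (pow_pos (pow_pos ht0 m) k)) Set.subset_union_left) hur'
      (pow_le_one₀ ht0.le ht1) le_rfl
  choose j hj using hstep
  -- pigeonhole through monotonicity: ONE member serves every m
  have hone : ∃ j₀ : Fin k, ∀ m : ℕ, ∀ v : HeightOneSpectrum (𝓞 K), v ∉ S' → ∀ 𝔓 ∈ v.primesAbove, ∀ σ : absoluteGaloisGroup K,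
      IsArithFrobAt (𝓞 K) σ 𝔓 → ∀ i : ℕ, Valued.v ((FramedRep.charpoly ρ σ - arithFrobPolyOfSatake ι v.residueCard 1 (α j₀ v)).coeff i) < t ^ m := by
    by_contra H
    push Not at H
    choose m hm using H
    let M : ℕ := Finset.univ.sup m
    obtain ⟨v, hv, 𝔓, h𝔓, σ, hσ, i, hi⟩ := hm (j M)
    have h1 := hj M v hv 𝔓 h𝔓 σ hσ i
    have h2 : t ^ M ≤ t ^ m (j M) := pow_le_pow_right_of_le_one' ht1 (Finset.le_sup (Finset.mem_univ (j M)))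
    exact absurd (h1.trans_le h2) (not_lt.mpr hi)
  obtain ⟨j₀, hj₀⟩ := hone
  refine ⟨π j₀, ((hw 1 one_pos).1 j₀).1, Filter.eventually_cofinite.mpr (hS'.subset fun v hv => ?_)⟩
  by_contra hvS'
  apply hv
  refine ⟨α j₀ v, ((hw 1 one_pos).1 j₀).2 v (fun h => hvS' (Or.inl h)), hur' v hvS', fun 𝔓 h𝔓 σ hσ => ?_⟩
  refine sub_eq_zero.mp (Polynomial.ext fun i => ?_)
  rw [Polynomial.coeff_zero, ← (Valued.v : Valuation (PadicAlgCl ℓ) NNReal).zero_iff]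
  -- a nonnegative real `< t ^ m` for every `m` is `0` (Archimedes)
  by_contra hne
  obtain ⟨m, hm⟩ := exists_pow_lt_of_lt_one (pos_iff_ne_zero.mpr hne) htlt
  exact absurd (hj₀ m v hvS' 𝔓 h𝔓 σ hσ i) (not_lt.mpr hm.le)

/-- **THE COMPATIBLE END OF THE DICTIONARY:** weak automorphy (ONE `π` with EXACT Satake–Frobenius compatibility a.e.) ⟺ frozen weak
pro-automorphy (ONE finite Hecke algebra of which `ρ` is an exact `𝒪`-point). -/
theorem weakly_iff_frozen (hur : ∀ᶠ v : HeightOneSpectrum (𝓞 K) in cofinite, ρ.IsUnramifiedAt v) :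
    IsWeaklyAutomorphic hcpt ι ρ ↔ IsFrozenWeaklyProAutomorphic hcpt ι ρ :=
  ⟨frozen_of_weakly, weakly_of_frozen hur⟩

/-- **THE LADDER IN ONE CURRENCY** (finite cuspidal families + `𝒪`-relations; dials = radius, SIZE, FREEZING): for an a.e.-unramified `ρ`,
H1 ⟺ wH1 (radius 1, any size) · C ⟺ C_b (every radius, bounded size) · weak automorphy ⟺ C_f (every radius, one frozen family);
C_w (every radius, free size) is the hub.  Hence HF = «families exist» (GROWTH), RANK = «sizes stay bounded» (RANK), CLASS = «one family can
be frozen» (RIGIDITY): three arrows of one ladder. -/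
theorem ladder_dictionary (hur : ∀ᶠ v : HeightOneSpectrum (𝓞 K) in cofinite, ρ.IsUnramifiedAt v) :
    (IsResiduallyAutomorphic hcpt ι ρ ↔ IsWeaklyResiduallyAutomorphic hcpt ι ρ) ∧
      (IsProAutomorphic hcpt ι ρ ↔ IsBoundedlyWeaklyProAutomorphic hcpt ι ρ) ∧
        (IsWeaklyAutomorphic hcpt ι ρ ↔ IsFrozenWeaklyProAutomorphic hcpt ι ρ) :=
  ⟨residual_iff_weaklyResidual hur, pro_iff_boundedWeak hur, weakly_iff_frozen hur⟩

end Exchange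

end Summit.Langlands.Langlands.Theorems.FernRank
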